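import Literature.NumberTheory.LFunctions.GaussianHeckeLandauBound
import Literature.NumberTheory.LFunctions.GaussianVonMangoldtBound
import Literature.NumberTheory.LFunctions.TwistedVonMangoldtSum
import HarnessLib

/-!
# The twisted prime-power sums `∑_{n ≤ x} ½ l_m(n) n^{it}` of `ℤ[i]` in a zero-free rectangle

Topic `Literature/NumberTheory/LFunctions`.  For `m ≥ 1` and real `t` put `b(n) = ½ l_m(n) n^{it}`, where
`l_m(n) = ∑_{N(π)^j = n} log N(π) λ^m(π)^j` are the coefficients of `P_m = -D_m'/D_m`
(`Literature.NumberTheory.LFunctions.GaussianHecke.lCoeff`); so `|b(n)| ≤ Λ(n)` (`GaussianVonMangoldtBound.lean`)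
and `∑ b(n) n^{-s} = ½ P_m(s - it) = -½ D_m'/D_m(s - it)`.  We PROVE, ZERO-FREE-REGION-AGNOSTICALLY:

* `GaussianHecke.twistData_of_zeroFree` — if `D_m(z) ≠ 0` for `Re z ≥ 1 - δ`, `|Im z| ≤ T + |t| + 1`
  (`0 < δ ≤ 5/64`, `T ≥ 1`), then the tree's contour-engine hypotheses
  `TwistedRieszMean.TwistData b G 0 1 (1 - δ/2) T B` hold with `G(s) = -½ D_m'/D_m(s - it)` and
  `B = C₁ log²(T + |t| + 2m + 6)/δ` (`GaussianHeckeLandauBound.lean`);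
* `GaussianHecke.exists_norm_twistedSum_le` — consequently (Landau's method: the contour estimate
  `TwistedRieszMean.TwistData.norm_rieszMean_sub_le` at `x` and `x + h ≤ 2x`, and the differencing step
  `TwistedRieszMean.TwistData.norm_sum_sub_le`): for `x ≥ e²`, `0 < h ≤ x`,
  `‖∑_{n ≤ x} b(n)‖ ≤ 5x² Q/h + h/2 + 1 + (ψ(x+h) - ψ(x))`,
  `Q = (2 log 2x + K₀)/T + 2B x^{-δ/2} + 2B/T²`, with absolute `K₀, C₁`.

This is the analytic core of Harman's Lemma 11.6 (*Prime-Detecting Sieves*, (11.4.5)); the choice of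
`δ` (a Vinogradov–Korobov/Coleman width), `T`, `h` and the passage to `∑_{R ≤ N(p) < S} λ^m(p) N(p)^{it}`
are made in the sequel.

## References

* G. Harman, *Prime-Detecting Sieves*, Princeton UP 2007, §11.4, Lemma 11.6. [Harman2007]
* H. L. Montgomery, R. C. Vaughan, *Multiplicative Number Theory I*, CUP 2007, §6.2 (proof of Thm 6.9).
  [MontgomeryVaughan2007]
-/

noncomputable section

open Complex Filter Topology Set Finset
open scoped ArithmeticFunction.vonMangoldt

namespace Literature.NumberTheory.LFunctions

namespace GaussianHecke

/-! ### The coefficients `b(n) = ½ l_m(n) n^{it}` and their Dirichlet series -/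

/-- `|½ l_m(n) n^{it}| ≤ Λ(n)`. [folklore] -/
theorem norm_half_lCoeff_twist_le (m : ℕ) (t : ℝ) (n : ℕ) :
    ‖lCoeff m n * (n : ℂ) ^ ((t : ℂ) * I) / 2‖ ≤ Λ n := by
  rcases eq_or_ne n 0 with rfl | hn
  · have h0 : lCoeff m 0 = 0 := by
      unfold lCoeff
      refine sum_eq_zero fun p hp ↦ ?_
      have := (mem_Icc.mp (mem_pairsNorm.mp hp).2.1)
      omega
    simp [h0]
  · rw [norm_div, norm_mul, Complex.norm_natCast_cpow_of_pos (Nat.pos_of_ne_zero hn)]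
    simp only [mul_re, ofReal_re, I_re, mul_zero, ofReal_im, I_im, mul_one, sub_self, Real.rpow_zero,
      mul_one, Complex.norm_ofNat]
    have := norm_lCoeff_le_two_mul_vonMangoldt m n
    linarith

/-- The terms: `b(n) n^{-s} = ½ l_m(n) n^{-(s - it)}`. [folklore] -/
theorem term_half_lCoeff_twist (m : ℕ) (t : ℝ) (s : ℂ) (n : ℕ) :
    LSeries.term (fun n ↦ lCoeff m n * (n : ℂ) ^ ((t : ℂ) * I) / 2) s n =
      LSeries.term (lCoeff m) (s - t * I) n / 2 := by
  rcases eq_or_ne n 0 with rfl | hn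
  · simp [LSeries.term_zero]
  have hn0 : (n : ℂ) ≠ 0 := Nat.cast_ne_zero.2 hn
  rw [LSeries.term_of_ne_zero hn, LSeries.term_of_ne_zero hn, Complex.cpow_sub _ _ hn0]
  have h1 : (n : ℂ) ^ s ≠ 0 := by rw [Ne, Complex.cpow_eq_zero_iff]; exact fun h ↦ hn0 h.1
  have h2 : (n : ℂ) ^ ((t : ℂ) * I) ≠ 0 := by
    rw [Ne, Complex.cpow_eq_zero_iff]; exact fun h ↦ hn0 h.1
  field_simp

/-- **`∑ b(n) n^{-s} = -½ D_m'(s - it)/D_m(s - it)`** for `Re s > 1`. [cite: HeckeMathZ1920, §7] -/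
theorem LSeries_half_lCoeff_twist (m : ℕ) (t : ℝ) {s : ℂ} (hs : 1 < s.re) :
    LSeries (fun n ↦ lCoeff m n * (n : ℂ) ^ ((t : ℂ) * I) / 2) s =
      -(deriv (heckeL m) (s - t * I) / heckeL m (s - t * I)) / 2 := by
  have hs' : 1 < (s - t * I).re := by simp [hs]
  rw [← neg_div, ← heckeP_eq_neg_deriv_div m hs', heckeP, LSeries, LSeries, ← tsum_div_const]
  exact tsum_congr fun n ↦ term_half_lCoeff_twist m t s n

/-! ### `TwistData` from a zero-free rectangle -/

/-- **The contour-engine hypotheses for `b(n) = ½ l_m(n) n^{it}`** (`m ≥ 1`), from a zero-free rectangle: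
with the absolute `C₁` of `GaussianHecke.exists_norm_logDeriv_le_of_zeroFree`, for `0 < δ ≤ 5/64`, `T ≥ 1`,
if `D_m(z) ≠ 0` for `Re z ≥ 1 - δ`, `|Im z| ≤ T + |t| + 1`, then
`TwistData b (s ↦ -½ D_m'/D_m(s - it)) 0 1 (1 - δ/2) T (C₁ log²(T + |t| + 2m + 6)/δ / 2)`.
[cite: MontgomeryVaughan2007, Theorem 6.9 (proof)] -/
theorem twistData_of_zeroFree {C₁ : ℝ} (hC₁ : 0 ≤ C₁)
    (hLandau : ∀ (m : ℕ), m ≠ 0 → ∀ (δ H : ℝ), 0 < δ → δ ≤ 5 / 64 → 0 ≤ H →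
      (∀ z : ℂ, 1 - δ ≤ z.re → |z.im| ≤ H + 1 → heckeL m z ≠ 0) →
      ∀ s : ℂ, 1 - δ / 2 ≤ s.re → s.re ≤ 2 → |s.im| ≤ H →
        heckeL m s ≠ 0 ∧
          ‖deriv (heckeL m) s / heckeL m s‖ ≤ C₁ * Real.log (H + 2 * m + 6) ^ 2 / δ)
    {m : ℕ} (hm : m ≠ 0) (t : ℝ) {δ T : ℝ} (hδ : 0 < δ) (hδ1 : δ ≤ 5 / 64) (hT : 1 ≤ T)
    (hzf : ∀ z : ℂ, 1 - δ ≤ z.re → |z.im| ≤ T + |t| + 1 → heckeL m z ≠ 0) :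
    TwistedRieszMean.TwistData (fun n ↦ lCoeff m n * (n : ℂ) ^ ((t : ℂ) * I) / 2)
      (fun s ↦ -(deriv (heckeL m) (s - t * I) / heckeL m (s - t * I)) / 2) 0 1 (1 - δ / 2) T
      (C₁ * Real.log (T + |t| + 2 * m + 6) ^ 2 / δ / 2) := by
  have hH : 0 ≤ T + |t| := by positivity
  have hkey := hLandau m hm δ (T + |t|) hδ hδ1 hH (fun z hz hzi ↦ hzf z hz (by linarith))
  -- points of the shifted rectangle
  have hrect : ∀ s ∈ Icc (1 - δ / 2) 2 ×ℂ Icc (-T) T,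
      1 - δ / 2 ≤ (s - t * I).re ∧ (s - t * I).re ≤ 2 ∧ |(s - t * I).im| ≤ T + |t| := by
    intro s hs
    obtain ⟨⟨hre1, hre2⟩, him1, him2⟩ := hs
    refine ⟨by simpa using hre1, by simpa using hre2, ?_⟩
    have him : (s - t * I).im = s.im - t := by simp
    rw [him]
    have h1 : |s.im| ≤ T := abs_le.2 ⟨him1, him2⟩
    calc |s.im - t| ≤ |s.im| + |t| := abs_sub _ _
      _ ≤ T + |t| := by linarith
  refine ⟨norm_half_lCoeff_twist_le m t, by simp, by simp, by linarith, by linarith, hT,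
    by positivity, fun s hs ↦ ?_, fun s hs ↦ ?_, fun s hs ↦ ?_⟩
  · rw [LSeries_half_lCoeff_twist m t hs, zero_div, zero_add]
  · obtain ⟨hre1, hre2, him⟩ := hrect s hs
    obtain ⟨hne, -⟩ := hkey (s - t * I) hre1 hre2 him
    have h := TwistedVonMangoldt.differentiableAt_neg_logDeriv_shift (differentiable_heckeL hm)
      (-(t * I)) (s := s) (by rwa [← sub_eq_add_neg])
    simp only [← sub_eq_add_neg] at h
    exact (h.div_const 2).differentiableWithinAt
  · obtain ⟨hre1, hre2, him⟩ := hrect s hs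
    obtain ⟨-, hle⟩ := hkey (s - t * I) hre1 hre2 him
    rw [norm_div, norm_neg, Complex.norm_ofNat]
    exact div_le_div_of_nonneg_right hle (by norm_num)

/-! ### The estimate for `∑_{n ≤ x} b(n)` -/

/-- **`∑_{n ≤ x} ½ l_m(n) n^{it}` in a zero-free rectangle** (Landau's method).  There are absolute
`K₀, C₁ ≥ 0` such that for all `m ≥ 1`, real `t`, `0 < δ ≤ 5/64`, `T ≥ 1` with `D_m(z) ≠ 0` on
`Re z ≥ 1 - δ`, `|Im z| ≤ T + |t| + 1`, and all `x ≥ e²`, `0 < h ≤ x`: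
`‖∑_{n ≤ x} b(n)‖ ≤ 5x² Q/h + h/2 + 1 + (ψ(x + h) - ψ(x))`, where
`Q = (2 log 2x + K₀)/T + 2B x^{(1-δ/2)-1} + 2B/T²`, `B = C₁ log²(T + |t| + 2m + 6)/δ / 2`
(contour estimates at `x` and `x + h`, then differencing; no main term since `D_m` is entire).
[cite: Harman2007, Lemma 11.6 (proof)] [cite: MontgomeryVaughan2007, Theorem 6.9 (proof)] -/
theorem exists_norm_twistedSum_le :
    ∃ K₀ C₁ : ℝ, 0 ≤ K₀ ∧ 0 ≤ C₁ ∧ ∀ (m : ℕ), m ≠ 0 → ∀ (t δ T : ℝ), 0 < δ → δ ≤ 5 / 64 → 1 ≤ T →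
      (∀ z : ℂ, 1 - δ ≤ z.re → |z.im| ≤ T + |t| + 1 → heckeL m z ≠ 0) →
      ∀ x h : ℝ, Real.exp 2 ≤ x → 0 < h → h ≤ x →
        ‖∑ n ∈ Finset.Ioc 0 ⌊x⌋₊, lCoeff m n * (n : ℂ) ^ ((t : ℂ) * I) / 2‖ ≤
          5 * x ^ 2 * ((2 * Real.log (2 * x) + K₀) / T +
              2 * (C₁ * Real.log (T + |t| + 2 * m + 6) ^ 2 / δ / 2) * x ^ (1 - δ / 2 - 1) +
              2 * (C₁ * Real.log (T + |t| + 2 * m + 6) ^ 2 / δ / 2) / T ^ 2) / h +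
            h / 2 + 1 + (Chebyshev.psi (x + h) - Chebyshev.psi x) := by
  obtain ⟨K₀, hK₀, hKL⟩ := TwistedRieszMean.exists_norm_LSeries_le
  obtain ⟨C₁, hC₁, hLandau⟩ := exists_norm_logDeriv_le_of_zeroFree
  refine ⟨K₀, C₁, hK₀, hC₁, fun m hm t δ T hδ hδ1 hT hzf x h hx hh hhx ↦ ?_⟩
  have hD := twistData_of_zeroFree hC₁ hLandau hm t hδ hδ1 hT hzf
  set b : ℕ → ℂ := fun n ↦ lCoeff m n * (n : ℂ) ^ ((t : ℂ) * I) / 2 with hbdef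
  set B : ℝ := C₁ * Real.log (T + |t| + 2 * m + 6) ^ 2 / δ / 2 with hBdef
  have hB0 : 0 ≤ B := by positivity
  have hx1 : 1 ≤ x := le_trans (by have := Real.add_one_le_exp (2 : ℝ); linarith) hx
  have hx0 : 0 < x := by linarith
  have hT0 : 0 < T := by linarith
  set y : ℝ := x + h with hydef
  have hxy : x < y := by rw [hydef]; linarith
  have hy2x : y ≤ 2 * x := by rw [hydef]; linarith
  have hye : Real.exp 2 ≤ y := by linarith
  have hy0 : 0 < y := by linarith
  -- the three analytic estimates
  have hIx := hD.norm_rieszMean_sub_le hK₀ hKL hx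
  have hIy := hD.norm_rieszMean_sub_le hK₀ hKL hye
  have hmain := hD.norm_sum_sub_le hx1 hxy
  simp only [zero_mul, sub_zero, zero_div] at hIx hIy hmain
  -- compare the brackets at `y` and at `x`
  set Q : ℝ := (2 * Real.log (2 * x) + K₀) / T + 2 * B * x ^ (1 - δ / 2 - 1) + 2 * B / T ^ 2 with hQdef
  have hlog2x : 0 ≤ Real.log (2 * x) := Real.log_nonneg (by linarith)
  have hQ0 : 0 ≤ Q := by
    rw [hQdef]
    refine add_nonneg (add_nonneg (div_nonneg (by linarith) hT0.le) (by positivity)) (by positivity)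
  have hlogxX : Real.log x ≤ Real.log (2 * x) := Real.log_le_log hx0 (by linarith)
  have hlogyX : Real.log y ≤ Real.log (2 * x) := Real.log_le_log hy0 hy2x
  have hPy : y ^ (1 - δ / 2 - 1) ≤ x ^ (1 - δ / 2 - 1) :=
    Real.rpow_le_rpow_of_nonpos hx0 hxy.le (by linarith)
  have hIx' : ‖TwistedRieszMean.rieszMeanC b x‖ ≤ x ^ 2 * Q := by
    refine hIx.trans (mul_le_mul_of_nonneg_left ?_ (by positivity))
    rw [hQdef]
    gcongr
  have hIy' : ‖TwistedRieszMean.rieszMeanC b y‖ ≤ 4 * x ^ 2 * Q := by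
    refine hIy.trans ?_
    have h1 : y ^ 2 ≤ 4 * x ^ 2 := by
      have := pow_le_pow_left₀ hy0.le hy2x 2; nlinarith
    have h2 : (2 * Real.log y + K₀) / T + 2 * B * y ^ (1 - δ / 2 - 1) + 2 * B / T ^ 2 ≤ Q := by
      rw [hQdef]; gcongr
    calc y ^ 2 * ((2 * Real.log y + K₀) / T + 2 * B * y ^ (1 - δ / 2 - 1) + 2 * B / T ^ 2)
        ≤ y ^ 2 * Q := mul_le_mul_of_nonneg_left h2 (by positivity)
      _ ≤ 4 * x ^ 2 * Q := mul_le_mul_of_nonneg_right h1 hQ0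
  have hyx : y - x = h := by rw [hydef]; ring
  have hfirst : (‖TwistedRieszMean.rieszMeanC b y‖ + ‖TwistedRieszMean.rieszMeanC b x‖) / h ≤
      5 * x ^ 2 * Q / h :=
    div_le_div_of_nonneg_right (by linarith) hh.le
  have hpsi : Chebyshev.psi y = Chebyshev.psi (x + h) := by rw [hydef]
  rw [← hpsi]
  rw [hyx] at hmain
  calc ‖∑ n ∈ Finset.Ioc 0 ⌊x⌋₊, b n‖
      ≤ (‖TwistedRieszMean.rieszMeanC b y‖ + ‖TwistedRieszMean.rieszMeanC b x‖) / h +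
          h / 2 + 1 + (Chebyshev.psi y - Chebyshev.psi x) := hmain
    _ ≤ 5 * x ^ 2 * Q / h + h / 2 + 1 + (Chebyshev.psi y - Chebyshev.psi x) := by
        linarith [hfirst]

end GaussianHecke

end Literature.NumberTheory.LFunctions
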